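import Literature.Topology.FourManifolds.BandSumInTube
import Literature.Topology.FourManifolds.ConnectedSumNormalForm
import Literature.Topology.FourManifolds.KnotsProofs
import HarnessLib

/-!
# Transport of a band sum in an end frame to normal position

Topic `Literature/Topology/FourManifolds`; sequel of `BandSumInTube.lean` in the decomposition
of the Fox–Milnor congruence `Literature.Topology.FourManifolds.Knot.IsConnectedSum.isConcordant`
(remaining named fact `Knot.exists_isConnectedSum_isConcordant_left`,
`BandSumConcordanceCore.lean`). The band sum `Knew` of the end knot `Kend` and the small copy
`tiny` of a knot `Kn` inside an end frame (`KnotPiece.InTube.bandData`) is shown to be a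
**connected sum** `Kend # Kn` (`Knot.IsConnectedSum`, `BandSum.lean`), granted an ambient isotopy
`Θ` of `𝕊³` whose end stage reads, in the stereographic chart `ψ` from the south pole, as the
frame composed with the affine contraction `T` on a ball `B̄(0, ρ')` containing `ψ ∘ Kn`
(`TubeEndCharts.exists_isIsotopic_tinyKnot` produces such `Θ`), and granted that the band chart
crosses the round model sphere `T (S(0, ρ'))` exactly in its middle line. Everything is proved:

* `exists_ambientIsotopy_smul` — a compactly supported ambient isotopy of `ℝ³` ending in the
  homothety `z ↦ κ z` on a ball (`AffineIsotopy.exists_ambientIsotopy_affine`).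
* `KnotsInBall.last_nonneg_iff_norm_psi_le`, `psi_symm_last_nonneg_iff`,
  `psi_symm_mem_sphereEquator_iff` — the closed northern hemisphere and the equator in the chart
  `ψ` (`‖ψ‖ ≤ 2`, `‖ψ‖ = 2`).
* **`KnotPiece.InTube.isConnectedSum_of_transport`** — with `Λ` the transported homothety of ratio
  `ρ'/2` and `Φ := rot_π ∘ Λ₁⁻¹ ∘ Θ₁⁻¹`, the presentation `(Kend, tiny, bandData)` is carried to a
  normal presentation (`Knot.IsNormalConnectedSum`: `Φ ∘ Kend` northern, `Φ ∘ tiny` southern, the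
  band crossing the equator in its middle line), hence `Knew` is a connected sum `Kend # Kn`
  (`IsNormalConnectedSum.isConnectedSum`, `IsConnectedSum.of_isIsotopic_right_holds`).

## References

* P. R. Cromwell, *Knots and Links* (2004), §4.6 (products of knots via a separating sphere and
  a rectangle meeting it in one arc). [Cromwell2004]
* R. H. Fox, J. W. Milnor, Osaka J. Math. 3 (1966), §1 (the consumer). [FoxMilnor1966]

## Design notes

No named facts, no `sorry`; `𝔼 n`, `𝕊 n` are local notation as in `Knots.lean`. The
`[SphereEmbedding.SmoothnessFacts]` instance needed by `IsNormalConnectedSum.isConnectedSum` (the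
standard equator) is the one of `KnotsProofs.lean`.
-/

open Set Function Metric
open scoped Topology ContDiff Manifold

noncomputable section

namespace Literature.Topology.FourManifolds

/-- Local notation: `𝔼 n` is the model Euclidean space `EuclideanSpace ℝ (Fin n)`. -/
local notation "𝔼 " n:arg => EuclideanSpace ℝ (Fin n)
/-- Local notation for the unit sphere `𝕊 n ⊆ 𝔼 (n+1)`. -/
local notation "𝕊 " n:arg => Metric.sphere (0 : EuclideanSpace ℝ (Fin (n + 1))) 1

attribute [local instance] fact_finrank_euclideanSpace_succ

/-! ### A compactly supported homothety isotopy of `ℝ³` -/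

/-- **The homothety `z ↦ κ z` (`κ > 0`) on a ball is the end of a compactly supported ambient
isotopy of `ℝ³`** (`AffineIsotopy.exists_ambientIsotopy_affine` with `L₀ = id`, `L₁ = κ id`).
[folklore] -/
theorem exists_ambientIsotopy_smul {κ : ℝ} (hκ : 0 < κ) (r : ℝ) :
    ∃ F : AmbientIsotopy 𝓘(ℝ, 𝔼 3) (𝔼 3), (∀ z ∈ closedBall (0 : 𝔼 3) r, F.toFun 1 z = κ • z) ∧
      ∃ R : ℝ, ∀ t (y : 𝔼 3), R ≤ ‖y‖ → F.toFun t y = y := by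
  set L₁ := smulEquiv hκ.ne' (ContinuousLinearEquiv.refl ℝ (𝔼 3)) with hL₁
  have hdet : 0 < (AffineIsotopy.toMat ((ContinuousLinearEquiv.refl ℝ (𝔼 3) : 𝔼 3 ≃L[ℝ] 𝔼 3) :
      𝔼 3 →L[ℝ] 𝔼 3)).det * (AffineIsotopy.toMat (L₁ : 𝔼 3 →L[ℝ] 𝔼 3)).det := by
    rw [hL₁, toMat_smulEquiv]
    have e : ((ContinuousLinearEquiv.refl ℝ (𝔼 3) : 𝔼 3 ≃L[ℝ] 𝔼 3) : 𝔼 3 →L[ℝ] 𝔼 3) =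
        ContinuousLinearMap.id ℝ (𝔼 3) := rfl
    rw [e, AffineIsotopy.toMat_id, Matrix.det_smul, Matrix.det_one, Fintype.card_fin]
    positivity
  obtain ⟨F, hF, R, hR⟩ := AffineIsotopy.exists_ambientIsotopy_affine (0 : 𝔼 3) 0 0
    (ContinuousLinearEquiv.refl ℝ (𝔼 3)) L₁ hdet r
  refine ⟨F, fun z hz ↦ ?_, R, hR⟩
  have := hF z hz
  simpa [hL₁, smulEquiv_apply] using this

/-! ### Hemispheres in the chart `ψ` -/

namespace KnotsInBall

/-- In the chart from the south pole, the closed northern hemisphere (minus nothing: the south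
pole is not in it) is the closed ball of radius `2`. [folklore] -/
theorem last_nonneg_iff_norm_psi_le {y : 𝕊 3} (hy : y ≠ southPole) :
    0 ≤ (y : 𝔼 4) (Fin.last 3) ↔ ‖psi y‖ ≤ 2 := by
  rw [psi, norm_stereographic'_le_two_iff southPole y hy, inner_southPole, neg_nonpos]

/-- The last coordinate of `ψ⁻¹ w` is nonnegative iff `‖w‖ ≤ 2`. [folklore] -/
theorem psi_symm_last_nonneg_iff (w : 𝔼 3) :
    0 ≤ ((psi.symm w : 𝕊 3) : 𝔼 4) (Fin.last 3) ↔ ‖w‖ ≤ 2 := by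
  rw [last_nonneg_iff_norm_psi_le (psi_symm_ne_southPole w), psi_apply_psi_symm]

/-- `ψ⁻¹ w` lies on the equator iff `‖w‖ = 2`. [folklore] -/
theorem psi_symm_mem_sphereEquator_iff (w : 𝔼 3) : psi.symm w ∈ sphereEquator 2 ↔ ‖w‖ = 2 := by
  rw [mem_sphereEquator_iff, le_antisymm_iff, le_antisymm_iff, psi_symm_last_nonneg_iff,
    ← not_lt, psi_symm_pos_iff, not_lt]
  tauto

/-- A point with nonnegative last coordinate is `ψ⁻¹` of a vector of norm `≤ 2`. [folklore] -/
theorem eq_psi_symm_of_last_nonneg {y : 𝕊 3} (hy : 0 ≤ (y : 𝔼 4) (Fin.last 3)) :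
    y = psi.symm (psi y) ∧ ‖psi y‖ ≤ 2 := by
  have hne : y ≠ southPole := ne_southPole_of_gt (by linarith)
  exact ⟨(psi_symm_apply_psi hne).symm, (last_nonneg_iff_norm_psi_le hne).1 hy⟩

end KnotsInBall

/-! ### Transport to normal position -/

namespace BandFoliation.KnotPiece.InTube

open KnotsInBall Knot.IsConicalConcordance SphereEmbedding

variable {C : ChartData} {D : SegData C} {P : KnotPiece C D} {η ε : ℝ} {E : EndFrame η ε}
  {Kend tiny Knew : Knot}

/-- Images of knots compose: `(K.map e).map e' = K.map (e.trans e')`. [folklore] -/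
theorem map_map (K : Knot) (e e' : 𝕊 3 ≃ₘ⟮𝓡 3, 𝓡 3⟯ 𝕊 3) : (K.map e).map e' = K.map (e.trans e') :=
  DFunLike.coe_injective rfl

/-- A knot is isotopic to its image under the inverse of the end stage of an ambient isotopy.
[folklore] -/
theorem isIsotopic_map_symm (K : Knot) (F : AmbientIsotopy (𝓡 3) (𝕊 3)) :
    K.IsIsotopic (K.map (F.toDiffeomorph 1).symm) := by
  have h : (K.map (F.toDiffeomorph 1).symm).IsIsotopic K := by
    have := (K.map (F.toDiffeomorph 1).symm).isIsotopic_map F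
    rwa [map_map, Diffeomorph.symm_trans_self, show K.map (Diffeomorph.refl (𝓡 3) (𝕊 3) ∞) = K from
      DFunLike.coe_injective rfl] at this
  exact SphereEmbedding.IsIsotopic.symm_holds h

/-- **Transport of a band sum in an end frame to normal position.** Let the band-sum
configuration `h` of `Knew` from `Kend` and `tiny` sit in the end frame `E`; let `Θ` be an ambient
isotopy of `𝕊³` with `Θ₁ ∘ ψ⁻¹ = cS ∘ T` on the closed ball `B̄(0, ρ')`, where `T` maps that ball
into the region of the frame, the small knot is `tiny = cS ∘ T ∘ ψ ∘ Kn` with `ψ ∘ Kn` inside the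
open ball, the end knot misses `cS (T (B̄(0, ρ')))`, and the band chart meets the model sphere
`T (S(0, ρ'))` exactly in its middle line. Then `Knew` is a connected sum `Kend # Kn`: with the
homothety isotopy `Λ` of ratio `ρ'/2` transported along `ψ`, the diffeomorphism
`Φ = rot_π ∘ Λ₁⁻¹ ∘ Θ₁⁻¹` carries `Kend` into the open northern hemisphere, `tiny` into the open
southern one and the model sphere onto the equator, so `(Φ ∘ Kend, Φ ∘ tiny, Φ ∘ band)` is a
normal presentation of `Φ ∘ Knew` (`Knot.IsNormalConnectedSum`), which is a connected sum
(`IsNormalConnectedSum.isConnectedSum`); and `Φ ∘ Knew ≅ Knew`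
(`IsConnectedSum.of_isIsotopic_right_holds`). Cromwell (2004), §4.6. [folklore] -/
theorem isConnectedSum_of_transport (h : P.InTube E Kend tiny Knew) {Kn : Knot}
    (hKn : ∀ y, Kn y ≠ southPole) (T : 𝔼 3 → 𝔼 3) {ρ' : ℝ} (hρ' : 0 < ρ')
    (Θ : AmbientIsotopy (𝓡 3) (𝕊 3))
    (hΘ : ∀ z ∈ closedBall (0 : 𝔼 3) ρ', Θ.toFun 1 (psi.symm z) = E.cS (T z))
    (hT : MapsTo T (closedBall (0 : 𝔼 3) ρ') (region 0 η ε))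
    (htinyT : ∀ y, tiny y = E.cS (T (psi (Kn y))))
    (hKnb : ∀ y, psi (Kn y) ∈ ball (0 : 𝔼 3) ρ')
    (hKend : ∀ y, ∀ z ∈ closedBall (0 : 𝔼 3) ρ', Kend y ≠ E.cS (T z))
    (hcirc : ∀ x ∈ squareNhd C.δ, (C.B x ∈ T '' sphere (0 : 𝔼 3) ρ' ↔ x 0 = 2⁻¹)) :
    Knot.IsConnectedSum Kend Kn Knew := by
  have h2ρ : 0 < 2 / ρ' := by positivity
  -- the homothety isotopy and its transport along `ψ`
  obtain ⟨Λ, hΛ, R, hR⟩ := exists_ambientIsotopy_smul (κ := ρ' / 2) (by positivity) 2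
  set Λs := Λ.alongChart (φ := psi) contMDiffOn_psi contMDiff_psi_symm psi_target hR with hΛs
  have hΛs_apply : ∀ y : 𝕊 3, y ≠ southPole → Λs.toFun 1 y = psi.symm (Λ.toFun 1 (psi y)) := fun y hy ↦ by
    rw [hΛs, AmbientIsotopy.alongChart_toFun, chartTransport_of_mem _ (mem_psi_source hy)]
  set ΘD := Θ.toDiffeomorph 1 with hΘD
  set ΛD := Λs.toDiffeomorph 1 with hΛD
  set Φ : 𝕊 3 ≃ₘ⟮𝓡 3, 𝓡 3⟯ 𝕊 3 := (ΘD.symm.trans ΛD.symm).trans halfTurn with hΦ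
  have hΦ_apply : ∀ y, Φ y = halfTurn (ΛD.symm (ΘD.symm y)) := fun y ↦ rfl
  -- (K1) the composite `Θ₁ ∘ Λ₁ ∘ ψ⁻¹ ∘ (2/ρ')` is `cS ∘ T` on the closed ball
  have key : ∀ z ∈ closedBall (0 : 𝔼 3) ρ', ΘD (ΛD (psi.symm ((2 / ρ') • z))) = E.cS (T z) := by
    intro z hz
    have hw : (2 / ρ') • z ∈ closedBall (0 : 𝔼 3) 2 := by
      rw [mem_closedBall_zero_iff, norm_smul, Real.norm_of_nonneg h2ρ.le]
      rw [mem_closedBall_zero_iff] at hz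
      calc 2 / ρ' * ‖z‖ ≤ 2 / ρ' * ρ' := mul_le_mul_of_nonneg_left hz h2ρ.le
        _ = 2 := by field_simp
    show Θ.toFun 1 (Λs.toFun 1 (psi.symm ((2 / ρ') • z))) = _
    rw [hΛs_apply _ (psi_symm_ne_southPole _), psi_apply_psi_symm,
      hΛ _ hw, smul_smul, show ρ' / 2 * (2 / ρ') = 1 by field_simp, one_smul, hΘ z hz]
  have hΦ_cS : ∀ z ∈ closedBall (0 : 𝔼 3) ρ', Φ (E.cS (T z)) = halfTurn (psi.symm ((2 / ρ') • z)) := by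
    intro z hz
    rw [hΦ_apply, ← key z hz, Diffeomorph.symm_apply_apply, Diffeomorph.symm_apply_apply]
  -- (K3) a point off `cS (T (B̄(0, ρ')))` is carried into the open northern hemisphere
  have north : ∀ y : 𝕊 3, (∀ z ∈ closedBall (0 : 𝔼 3) ρ', y ≠ E.cS (T z)) →
      0 < ((Φ y : 𝕊 3) : 𝔼 4) (Fin.last 3) := by
    intro y hy
    rw [hΦ_apply, halfTurn_apply_last, neg_pos]
    by_contra hge
    push Not at hge
    set q := ΛD.symm (ΘD.symm y) with hq
    obtain ⟨hq1, hq2⟩ := eq_psi_symm_of_last_nonneg hge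
    set z := (ρ' / 2) • psi q with hz
    have hzb : z ∈ closedBall (0 : 𝔼 3) ρ' := by
      rw [mem_closedBall_zero_iff, hz, norm_smul, Real.norm_of_nonneg (by positivity)]
      calc ρ' / 2 * ‖psi q‖ ≤ ρ' / 2 * 2 := mul_le_mul_of_nonneg_left hq2 (by positivity)
        _ = ρ' := by ring
    have hzq : (2 / ρ') • z = psi q := by
      rw [hz, smul_smul, show 2 / ρ' * (ρ' / 2) = 1 by field_simp, one_smul]
    apply hy z hzb
    rw [← key z hzb, hzq, ← hq1, hq, Diffeomorph.apply_symm_apply, Diffeomorph.apply_symm_apply]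
  -- the three knots carried by `Φ`
  have hN : (Kend.map Φ).InNorth := fun x ↦ north _ (hKend x)
  have hS : (tiny.map Φ).InSouth := by
    intro x
    rw [SphereEmbedding.map_apply, htinyT, hΦ_cS _ (ball_subset_closedBall (hKnb x)), halfTurn_apply_last,
      neg_lt_zero, psi_symm_pos_iff, norm_smul, Real.norm_of_nonneg h2ρ.le]
    have := mem_ball_zero_iff.1 (hKnb x)
    calc 2 / ρ' * ‖psi (Kn x)‖ < 2 / ρ' * ρ' := mul_lt_mul_of_pos_left this h2ρ
      _ = 2 := by field_simp
  -- isotopies: `K ≅ Φ ∘ K` for every knot, and `tiny = Θ₁ ∘ Kn`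
  have hiso : ∀ K : Knot, K.IsIsotopic (K.map Φ) := by
    intro K
    rw [hΦ, ← map_map, ← map_map]
    refine SphereEmbedding.IsIsotopic.trans_holds ?_ (((K.map ΘD.symm).map ΛD.symm).isIsotopic_map_halfTurn)
    refine SphereEmbedding.IsIsotopic.trans_holds ?_ ((isIsotopic_map_symm (K.map ΘD.symm) Λs))
    exact isIsotopic_map_symm K Θ
  have htinyΘ : tiny = Kn.map ΘD := by
    apply DFunLike.coe_injective
    funext y
    rw [SphereEmbedding.coe_map, comp_apply, hΘD, AmbientIsotopy.coe_toDiffeomorph, htinyT,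
      ← hΘ _ (ball_subset_closedBall (hKnb y)), psi_symm_apply_psi (hKn y)]
  have hKn_tiny : Kn.IsIsotopic (tiny.map Φ) := by
    refine SphereEmbedding.IsIsotopic.trans_holds ?_ (hiso tiny)
    rw [htinyΘ]; exact Kn.isIsotopic_map Θ
  -- the transported band data and the crossing condition
  obtain ⟨b', hband, hδ⟩ := h.bandData.exists_map Φ
  have hcross : b'.band ⁻¹' sphereEquator 2 ∩ squareNhd b'.δ = {x ∈ squareNhd b'.δ | x 0 = 2⁻¹} := by
    rw [hband, hδ, bandData_δ, bandData_band]
    ext x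
    simp only [mem_inter_iff, mem_preimage, comp_apply, mem_setOf_eq]
    constructor
    · rintro ⟨hx, hsq⟩
      refine ⟨hsq, (hcirc x hsq).1 ?_⟩
      -- `Φ (cS (B x))` on the equator: pull back along `key`
      rw [hΦ_apply, mem_sphereEquator_iff, halfTurn_apply_last, neg_eq_zero] at hx
      set q := ΛD.symm (ΘD.symm (E.cS (C.B x))) with hq
      obtain ⟨hq1, -⟩ := eq_psi_symm_of_last_nonneg hx.ge
      have hq2 : ‖psi q‖ = 2 := by
        rw [← psi_symm_mem_sphereEquator_iff, ← hq1]; exact (mem_sphereEquator_iff _).2 hx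
      set z := (ρ' / 2) • psi q with hz
      have hzs : z ∈ sphere (0 : 𝔼 3) ρ' := by
        rw [mem_sphere_zero_iff_norm, hz, norm_smul, Real.norm_of_nonneg (by positivity), hq2]; ring
      have hzq : (2 / ρ') • z = psi q := by
        rw [hz, smul_smul, show 2 / ρ' * (ρ' / 2) = 1 by field_simp, one_smul]
      have hkey := key z (sphere_subset_closedBall hzs)
      rw [hzq, ← hq1, hq, Diffeomorph.apply_symm_apply, Diffeomorph.apply_symm_apply] at hkey
      refine ⟨z, hzs, (E.injOn_c (hT (sphere_subset_closedBall hzs)) (h.B_mem x) ?_).symm |>.symm⟩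
      simpa using (congrArg (fun p : 𝕊 3 ↦ (p : 𝔼 4)) hkey).symm
    · rintro ⟨hsq, hx0⟩
      refine ⟨?_, hsq⟩
      obtain ⟨z, hz, hzB⟩ := (hcirc x hsq).2 hx0
      rw [← hzB, hΦ_cS z (sphere_subset_closedBall hz), mem_sphereEquator_iff, halfTurn_apply_last,
        neg_eq_zero, ← mem_sphereEquator_iff, psi_symm_mem_sphereEquator_iff, norm_smul,
        Real.norm_of_nonneg h2ρ.le, mem_sphere_zero_iff_norm.1 hz]
      field_simp
  -- the normal presentation of `Φ ∘ Knew`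
  have hnormal : Knot.IsNormalConnectedSum Kend Kn (Knew.map Φ) :=
    ⟨Kend.map Φ, tiny.map Φ, hiso Kend, hKn_tiny, hN, hS, b', hcross⟩
  exact Knot.IsConnectedSum.of_isIsotopic_right_holds hnormal.isConnectedSum
    (SphereEmbedding.IsIsotopic.symm_holds (hiso Knew))

end BandFoliation.KnotPiece.InTube

end Literature.Topology.FourManifolds
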